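import Summits.CriticalPhenomena.SAWScalingLimit.Theorems.SAWDefectDecoherenceBoundaryClosureRGateFrameRegular
import Mathlib.Analysis.Calculus.Deriv.Star
import HarnessLib

/-!
# Crux `BoundaryClosureR` (stmt-CriticalPhenomena-14004), line `polygon-parity-squeeze`,
# stub `boundaryPhaseBookkeeping` (piece D): boundary values of `arg Φ'` at flat boundary points

Let `D` be a Dobrushin domain, `Φ : Ω → ℍₒ` a conformal equivalence of its carrier with
`‖Φ‖ → ∞` at the root `D.pt 0`, and `L` a continuous logarithm of `Φ'` on `Ω`.

* `reflect_core` — the Schwarz reflection `R` of a function `g` continuous on the closed upper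
  half-disc `B(0,s) ∩ {im ≥ 0}`, holomorphic with `im g > 0` on the open half-disc and real on
  the diameter is holomorphic on `B(0, s)` with `R'(0) > 0` (boundary Hopf lemma: `R'(0) ≠ 0` is
  real; the sign from `im (R(it) - R(0)) > 0`).
* `flatChart` — at a FLAT boundary point `z` with unit inner normal `n`
  (`Ω ∩ B(z, s) = {Re((w - z) conj n) > 0} ∩ B(z, s)`, root outside the ball): `im L` has a
  boundary value `α` within `Ω` at every point of the side line near `z`, the SAME `α` for all of
  them, and `e^{iα} = i conj n` (the side is traversed with `Ω` on the left and `Φ` increases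
  along it).  Proof: in the chart `w ↦ z - i n w` reflect the Carathéodory extension across the
  diameter (`reflect_core`); `Φ' ∘ chart = R' · i conj n` has the local holomorphic logarithm
  `log(R'/R'(0)) + log R'(0) + iβ`, `e^{iβ} = i conj n`, which differs from `L ∘ chart` by a
  constant `2πim` on the upper half-disc (`sub_eq_sub_of_exp_eq_mul_exp`); on the diameter
  `R' > 0`.
* `slit_false` — the SLIT configuration `Ω ∩ B(z, s) = {Re((w - z) conj n) ≠ 0} ∩ B(z, s)` is
  impossible: reflecting from above and (after conjugation) from below gives two holomorphic
  functions with POSITIVE derivative at `0` whose sum vanishes on the diameter.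

References: Pommerenke, *Boundary Behaviour of Conformal Maps* (1992), Thm. 2.6 and §3.1.
-/

noncomputable section

open scoped Topology ComplexConjugate
open Filter Set Metric Complex
open UpperHalfPlane (upperHalfPlaneSet)
open Literature.Probability.RandomPlanarGeometry
open Summit.CriticalPhenomena.SAWScalingLimit.Theorems.PickHalfPlane

namespace Summit.CriticalPhenomena.SAWScalingLimit.Theorems.PolygonParitySqueeze

namespace PhaseChart

/-! ### 1. Reflection across the diameter with positive derivative -/

/-- **Schwarz reflection with positive derivative at the centre.** If `g` is continuous on the
closed upper half-disc `B(0, s) ∩ {im ≥ 0}`, holomorphic with positive imaginary part on the open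
upper half-disc and real on the diameter, then its Schwarz reflection `R` is holomorphic on
`B(0, s)` and `R'(0)` is real and positive. [cite: PommerenkeBBCM1992, Thm. 2.6] -/
theorem reflect_core {g : ℂ → ℂ} {s : ℝ} (hs : 0 < s)
    (hc : ContinuousOn g (ball (0 : ℂ) s ∩ {w | 0 ≤ w.im}))
    (hd : DifferentiableOn ℂ g (ball (0 : ℂ) s ∩ {w | 0 < w.im}))
    (hreal : ∀ w ∈ ball (0 : ℂ) s, w.im = 0 → (g w).im = 0)
    (hpos : ∀ w ∈ ball (0 : ℂ) s, 0 < w.im → 0 < (g w).im) :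
    DifferentiableOn ℂ (schwarzReflection g) (ball (0 : ℂ) s) ∧
      0 < (deriv (schwarzReflection g) 0).re ∧ (deriv (schwarzReflection g) 0).im = 0 := by
  have hsymm : ∀ w ∈ ball (0 : ℂ) s, conj w ∈ ball (0 : ℂ) s := fun w hw => by
    rwa [mem_ball_zero_iff, norm_conj, ← mem_ball_zero_iff]
  set R : ℂ → ℂ := schwarzReflection g with hRdef
  have hR : DifferentiableOn ℂ R (ball (0 : ℂ) s) :=
    differentiableOn_schwarzReflection isOpen_ball hsymm hc hd
      (fun w hw hwim => conj_eq_iff_im.2 (hreal w hw hwim))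
  have hRup : ∀ w : ℂ, 0 ≤ w.im → R w = g w := fun w hwim => schwarzReflection_of_nonneg hwim
  have hb0s : ball (0 : ℂ) s ∈ 𝓝 (0 : ℂ) := isOpen_ball.mem_nhds (mem_ball_self hs)
  have hR0 : deriv R 0 ≠ 0 ∧ (deriv R 0).im = 0 := by
    refine Identification.identification_gateHopf R 0 (by simp) (hR.analyticAt hb0s) ?_ ?_
    · filter_upwards [hb0s] with w hw hwim
      rw [hRup w hwim.symm.le]
      exact hreal w hw hwim
    · filter_upwards [hb0s] with w hw hwim
      rw [hRup w hwim.le]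
      exact hpos w hw hwim
  refine ⟨hR, ?_, hR0.2⟩
  -- the sign: `re ((R(it) - R 0)/(it)) = im (R(it) - R(0)) / t > 0`
  have hR00 : (R 0).im = 0 := by
    rw [hRup 0 (by simp)]
    exact hreal 0 (mem_ball_self hs) (by simp)
  have hRd0 : HasDerivAt R (deriv R 0) 0 := (hR.differentiableAt hb0s).hasDerivAt
  have h1 : Tendsto (fun z => (R z - R 0) / z) (𝓝[≠] 0) (𝓝 (deriv R 0)) := by
    refine hRd0.tendsto_slope_zero.congr' (eventually_nhdsWithin_of_forall fun z _ => ?_)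
    simp only [zero_add, smul_eq_mul, div_eq_inv_mul]
  have h2 : Tendsto (fun t : ℝ => (I * t : ℂ)) (𝓝[>] 0) (𝓝[≠] 0) := by
    refine tendsto_nhdsWithin_iff.2 ⟨?_, ?_⟩
    · have : Continuous fun t : ℝ => (I * t : ℂ) := by fun_prop
      simpa using (this.tendsto 0).mono_left nhdsWithin_le_nhds
    · filter_upwards [self_mem_nhdsWithin] with t ht
      exact mul_ne_zero I_ne_zero (ofReal_ne_zero.2 (ne_of_gt ht))
  have h3 := (continuous_re.tendsto _).comp (h1.comp h2)
  have hev : ∀ᶠ t : ℝ in 𝓝[>] 0, 0 < ((R (I * t) - R 0) / (I * t)).re := by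
    have hev' : ∀ᶠ t : ℝ in 𝓝[>] 0, t < s := nhdsWithin_le_nhds (Iio_mem_nhds hs)
    filter_upwards [hev', self_mem_nhdsWithin] with t hts ht0
    have ht0 : 0 < t := ht0
    have hmem : (I * t : ℂ) ∈ ball (0 : ℂ) s := by
      rw [mem_ball_zero_iff, norm_mul, norm_I, one_mul, norm_real, Real.norm_of_nonneg ht0.le]
      exact hts
    have him : 0 < (I * t : ℂ).im := by simp [ht0]
    have hposI : 0 < (R (I * t) - R 0).im := by
      rw [sub_im, hR00, sub_zero, hRup _ him.le]
      exact hpos _ hmem him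
    have hcalc : ((R (I * t) - R 0) / (I * t)).re = (R (I * t) - R 0).im / t := by
      have hz : (I * t : ℂ) ≠ 0 := mul_ne_zero I_ne_zero (ofReal_ne_zero.2 ht0.ne')
      set u : ℂ := R (I * t) - R 0
      have : u = (u / (I * t)) * (I * t) := by rw [div_mul_cancel₀ _ hz]
      conv_rhs => rw [this]
      simp only [mul_im, mul_re, I_re, I_im, ofReal_re, ofReal_im, zero_mul, one_mul, mul_zero,
        sub_zero, add_zero, zero_add]
      field_simp
    rw [hcalc]
    exact div_pos hposI ht0
  have hge : 0 ≤ (deriv R 0).re := ge_of_tendsto h3 (hev.mono fun t ht => ht.le)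
  rcases hge.lt_or_eq with hlt | heq
  · exact hlt
  · exact absurd (Complex.ext heq.symm (by simpa using hR0.2)) hR0.1

/-! ### 2. Boundary values of `im L` at flat points -/

/-- **Boundary values of `arg Φ'` on a flat side.** Let `Φ : Ω → ℍₒ` be a conformal frame of the
Dobrushin domain `D` (`‖Φ‖ → ∞` at the root) and `L` a continuous logarithm of `Φ'` on `Ω`.  If
`Ω ∩ B(z, s) = {Re((w - z) conj n) > 0} ∩ B(z, s)` for a unit vector `n`, with the root outside
`B(z, s)`, then there are `0 < t ≤ s` and a real `α` with `e^{iα} = i conj n` such that `im L → α`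
within `Ω` at every point of the side line `Re((q - z) conj n) = 0` in `B(z, t)`.
[cite: PommerenkeBBCM1992, Thm. 2.6] -/
theorem flatChart (D : DobrushinDomain) (Φ : ConformalEquiv D.carrier upperHalfPlaneSet)
    (hΦ0 : Tendsto (fun z => ‖Φ z‖) (𝓝[D.carrier] (D.pt 0)) atTop)
    {L : ℂ → ℂ} (hL : ContinuousOn L D.carrier)
    (hexp : ∀ z ∈ D.carrier, exp (L z) = deriv Φ z)
    {z n : ℂ} (hn : ‖n‖ = 1) {s : ℝ} (hs : 0 < s)
    (hflat : D.carrier ∩ ball z s = {w : ℂ | 0 < ((w - z) * conj n).re} ∩ ball z s)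
    (h0 : D.pt 0 ∉ ball z s) :
    ∃ (t : ℝ) (α : ℝ), 0 < t ∧ t ≤ s ∧ exp ((α : ℂ) * I) = I * conj n ∧
      ∀ q ∈ ball z t, ((q - z) * conj n).re = 0 →
        Tendsto (fun w => (L w).im) (𝓝[D.carrier] q) (𝓝 α) := by
  obtain ⟨Φs, hΦsc, hΦse, hΦsr⟩ := Identification.exists_frameExtension D Φ hΦ0
  have hU : IsOpen D.carrier := D.isOpen
  -- unit algebra
  have hnn : n * conj n = 1 := by
    rw [mul_conj, normSq_eq_norm_sq, hn]; simp
  set τ : ℂ := -I * n with hτ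
  have hτ1 : ‖τ‖ = 1 := by rw [hτ, norm_mul, norm_neg, norm_I, one_mul, hn]
  have hττ : τ * conj τ = 1 := by
    rw [mul_conj, normSq_eq_norm_sq, hτ1]; simp
  have hττ' : conj τ * τ = 1 := by rw [mul_comm, hττ]
  have hτinv : τ * (I * conj n) = 1 := by
    rw [hτ, show -I * n * (I * conj n) = -(I * I) * (n * conj n) by ring, hnn, I_mul_I]
    norm_num
  -- the chart `A w = z + τ w`
  set A : ℂ → ℂ := fun w => z + τ * w with hA
  have hAlev : ∀ w, ((A w - z) * conj n).re = w.im := by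
    intro w
    simp only [hA]
    rw [add_sub_cancel_left, hτ, show -I * n * w * conj n = -I * w * (n * conj n) by ring, hnn,
      mul_one]
    simp
  have hAdist : ∀ w, dist (A w) z = ‖w‖ := by
    intro w
    rw [dist_eq_norm]
    simp only [hA]
    rw [add_sub_cancel_left, norm_mul, hτ1, one_mul]
  have hAball : ∀ {w : ℂ} {r : ℝ}, w ∈ ball (0 : ℂ) r ↔ A w ∈ ball z r := by
    intro w r
    rw [mem_ball_zero_iff, mem_ball, hAdist]
  have hAinv : ∀ w, A (conj τ * (w - z)) = w := by
    intro w
    simp only [hA]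
    rw [← mul_assoc, hττ, one_mul, add_sub_cancel]
  have hAc : Continuous A := by
    simp only [hA]
    fun_prop
  -- membership
  have hcar : ∀ w ∈ ball (0 : ℂ) s, (A w ∈ D.carrier ↔ 0 < w.im) := by
    intro w hw
    have h := Set.ext_iff.1 hflat (A w)
    simp only [mem_inter_iff, mem_setOf_eq, hAlev, hAball.1 hw, and_true] at h
    exact h
  have hmemU : ∀ w ∈ ball (0 : ℂ) s, 0 < w.im → A w ∈ D.carrier := fun w hw h => (hcar w hw).2 h
  have haxis_cl : ∀ w ∈ ball (0 : ℂ) s, w.im = 0 → A w ∈ closure D.carrier := by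
    intro w hw hwim
    have hray := Identification.tendsto_ray (A w) (τ * I)
    refine mem_closure_of_tendsto hray ?_
    have hcont : Continuous fun r : ℝ => w + (r : ℂ) * I := by fun_prop
    have hw0 : w + ((0 : ℝ) : ℂ) * I ∈ ball (0 : ℂ) s := by simpa using hw
    have hwball : ∀ᶠ r : ℝ in 𝓝[>] 0, w + (r : ℂ) * I ∈ ball (0 : ℂ) s :=
      nhdsWithin_le_nhds ((hcont.tendsto 0) (isOpen_ball.mem_nhds hw0))
    filter_upwards [hwball, self_mem_nhdsWithin] with r hr hr0
    have hr0 : (0 : ℝ) < r := hr0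
    have : A w + (r : ℂ) * (τ * I) = A (w + (r : ℂ) * I) := by
      simp only [hA]; ring
    rw [this]
    exact hmemU _ hr (by simpa [hwim] using hr0)
  have haxis_fr : ∀ w ∈ ball (0 : ℂ) s, w.im = 0 → A w ∈ frontier D.carrier := by
    intro w hw hwim
    rw [frontier, hU.interior_eq]
    refine ⟨haxis_cl w hw hwim, fun h => ?_⟩
    have := (hcar w hw).1 h
    rw [hwim] at this
    exact lt_irrefl _ this
  have hclos : ∀ w ∈ ball (0 : ℂ) s, 0 ≤ w.im → A w ∈ closure D.carrier \ {D.pt 0} := by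
    intro w hw hwim
    refine ⟨?_, fun h => h0 (mem_singleton_iff.1 h ▸ hAball.1 hw)⟩
    rcases hwim.lt_or_eq with hlt | heq
    · exact subset_closure (hmemU w hw hlt)
    · exact haxis_cl w hw heq.symm
  -- the pulled-back function and its reflection
  set g : ℂ → ℂ := fun w => Φs (A w) with hg
  have hgc : ContinuousOn g (ball (0 : ℂ) s ∩ {w | 0 ≤ w.im}) :=
    hΦsc.comp hAc.continuousOn fun w hw => hclos w hw.1 hw.2
  have hgd : DifferentiableOn ℂ g (ball (0 : ℂ) s ∩ {w | 0 < w.im}) := by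
    rintro w ⟨hw, hwim⟩
    have hwy : A w ∈ D.carrier := hmemU w hw hwim
    have h1 : DifferentiableAt ℂ Φs (A w) :=
      ((Φ.differentiableOn _ hwy).differentiableAt (hU.mem_nhds hwy)).congr_of_eventuallyEq
        (Filter.eventuallyEq_of_mem (hU.mem_nhds hwy) hΦse)
    have hAd : DifferentiableAt ℂ A w := by
      simp only [hA]; fun_prop
    exact (h1.comp w hAd).differentiableWithinAt
  have hgreal : ∀ w ∈ ball (0 : ℂ) s, w.im = 0 → (g w).im = 0 := fun w hw hwim =>
    hΦsr _ (haxis_fr w hw hwim)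
  have hgpos : ∀ w ∈ ball (0 : ℂ) s, 0 < w.im → 0 < (g w).im := by
    intro w hw hwim
    simp only [hg]
    rw [hΦse (hmemU w hw hwim)]
    exact Φ.mapsTo (hmemU w hw hwim)
  obtain ⟨hR, hR0pos, hR0im⟩ := reflect_core hs hgc hgd hgreal hgpos
  set R : ℂ → ℂ := schwarzReflection g with hRdef
  have hRup : ∀ w ∈ ball (0 : ℂ) s, 0 < w.im → R w = Φ (A w) := fun w hw hwim => by
    rw [hRdef, schwarzReflection_of_nonneg hwim.le]
    exact hΦse (hmemU w hw hwim)
  have hRreal : ∀ w ∈ ball (0 : ℂ) s, w.im = 0 → (R w).im = 0 := fun w hw hwim => by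
    rw [hRdef, schwarzReflection_of_nonneg hwim.symm.le]
    exact hgreal w hw hwim
  -- `R'` near `0`
  set R' : ℂ → ℂ := deriv R with hR'def
  have hR'c : ContinuousOn R' (ball (0 : ℂ) s) := ((hR.analyticOnNhd isOpen_ball).deriv).continuousOn
  have hR'0 : R' 0 = (((R' 0).re : ℝ) : ℂ) := Complex.ext (by simp) (by rw [ofReal_im]; exact hR0im)
  have hR'0ne : R' 0 ≠ 0 := fun h => by
    have : (R' 0).re = 0 := by rw [h, zero_re]
    rw [hR'def] at this
    linarith
  have hb0s : ball (0 : ℂ) s ∈ 𝓝 (0 : ℂ) := isOpen_ball.mem_nhds (mem_ball_self hs)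
  obtain ⟨δ, hδ, hδR⟩ :=
    Metric.continuousAt_iff.1 (hR'c.continuousAt hb0s) ‖R' 0‖ (norm_pos_iff.2 hR'0ne)
  set t : ℝ := min s δ with ht
  have ht0 : 0 < t := lt_min hs hδ
  have hts : t ≤ s := min_le_left _ _
  have htball : ball (0 : ℂ) t ⊆ ball 0 s := ball_subset_ball hts
  have hnear : ∀ w ∈ ball (0 : ℂ) t, ‖R' w / R' 0 - 1‖ < 1 := by
    intro w hw
    have h1 : dist (R' w) (R' 0) < ‖R' 0‖ := by
      refine hδR ?_
      have := mem_ball.1 hw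
      exact lt_of_lt_of_le this (min_le_right _ _)
    rw [show R' w / R' 0 - 1 = (R' w - R' 0) / R' 0 by field_simp, norm_div,
      div_lt_one (norm_pos_iff.2 hR'0ne), ← dist_eq_norm]
    exact h1
  have hslit : ∀ w ∈ ball (0 : ℂ) t, R' w / R' 0 ∈ slitPlane := fun w hw => by
    have := mem_slitPlane_of_norm_lt_one (hnear w hw)
    rwa [add_sub_cancel] at this
  have hrepos : ∀ w ∈ ball (0 : ℂ) t, 0 < (R' w / R' 0).re := by
    intro w hw
    have h := lt_of_le_of_lt (abs_re_le_norm _) (hnear w hw)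
    rw [sub_re, one_re, abs_lt] at h
    linarith [h.1]
  -- the direction `β`, `e^{iβ} = i conj n`
  set β : ℝ := arg (I * conj n) with hβ_def
  have hβ : exp ((β : ℂ) * I) = I * conj n := by
    have h1 : ‖I * conj n‖ = 1 := by rw [norm_mul, norm_I, norm_conj, hn, one_mul]
    have := norm_mul_exp_arg_mul_I (I * conj n)
    rwa [h1, ofReal_one, one_mul] at this
  -- the local logarithm `M` of `w ↦ Φ'(A w) = R' w · i conj n`
  set M : ℂ → ℂ := fun w => log (R' w / R' 0) + ((Real.log (R' 0).re : ℝ) : ℂ) + (β : ℂ) * I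
    with hM
  have hMexp : ∀ w ∈ ball (0 : ℂ) t, exp (M w) = R' w * (I * conj n) := by
    intro w hw
    simp only [hM]
    rw [exp_add, exp_add, exp_log (slitPlane_ne_zero (hslit w hw)), hβ, ofReal_log hR0pos.le,
      exp_log (by rw [← hR'0]; exact hR'0ne), ← hR'0, div_mul_cancel₀ _ hR'0ne]
  have hMc : ContinuousOn M (ball (0 : ℂ) t) := by
    refine (ContinuousOn.add ?_ continuousOn_const).add continuousOn_const
    exact ContinuousOn.comp (g := log) (fun x hx => (continuousAt_clog hx).continuousWithinAt)
      ((hR'c.mono htball).div_const _) hslit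
  have hMim : ∀ w ∈ ball (0 : ℂ) t, w.im = 0 → (M w).im = β := by
    intro w hw hwim
    have h1 : (R' w).im = 0 := by
      refine Identification.im_deriv_eq_zero_of_real hwim
        (hR.differentiableAt (isOpen_ball.mem_nhds (htball hw))) ?_
      filter_upwards [isOpen_ball.mem_nhds (htball hw)] with w' hw' hw'im
      exact hRreal w' hw' hw'im
    have h2 : (R' w / R' 0).im = 0 := by
      rw [hR'0, div_ofReal_im, h1, zero_div]
    have h3 : arg (R' w / R' 0) = 0 := arg_eq_zero_iff.2 ⟨(hrepos w hw).le, h2⟩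
    simp only [hM]
    rw [add_im, add_im, log_im, h3, ofReal_im, mul_im, ofReal_re, ofReal_im, I_re, I_im]
    ring
  -- on the upper half-disc `N`, `L ∘ A` and `M` are two logarithms of the same function
  set N : Set ℂ := ball (0 : ℂ) t ∩ {w | 0 < w.im} with hN
  have hNpc : IsPreconnected N :=
    ((convex_ball (0 : ℂ) t).inter (convex_halfSpace_im_gt 0)).isPreconnected
  have hNU : ∀ w ∈ N, A w ∈ D.carrier := fun w hw => hmemU w (htball hw.1) hw.2
  have hLA : ContinuousOn (fun w => L (A w)) N := hL.comp hAc.continuousOn hNU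
  have hMN : ContinuousOn M N := hMc.mono inter_subset_left
  have hderiv : ∀ w ∈ N, deriv Φ (A w) = R' w * (I * conj n) := by
    intro w hw
    have hev : R =ᶠ[𝓝 w] fun w' => Φ (A w') := by
      filter_upwards [isOpen_ball.mem_nhds (htball hw.1),
        (isOpen_lt continuous_const continuous_im).mem_nhds hw.2] with w' hw' hw'im
      exact hRup w' hw' hw'im
    have hAd : HasDerivAt A τ w := by
      have h := ((hasDerivAt_id w).const_mul τ).const_add z
      simpa [hA] using h
    have hΦd : DifferentiableAt ℂ Φ (A w) :=
      (Φ.differentiableOn _ (hNU w hw)).differentiableAt (hU.mem_nhds (hNU w hw))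
    have hcomp : HasDerivAt (fun w' => Φ (A w')) (deriv Φ (A w) * τ) w :=
      hΦd.hasDerivAt.comp w hAd
    have h1 : R' w = deriv Φ (A w) * τ := by rw [hR'def, hev.deriv_eq, hcomp.deriv]
    rw [h1, mul_assoc, hτinv, mul_one]
  have hexpN : ∀ w ∈ N, exp (L (A w)) = ((1 : ℝ) : ℂ) * exp (M w) := by
    intro w hw
    rw [ofReal_one, one_mul, hMexp w hw.1, hexp _ (hNU w hw), hderiv w hw]
  set q₀ : ℂ := ((t / 2 : ℝ) : ℂ) * I with hq₀
  have hq₀N : q₀ ∈ N := by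
    refine ⟨?_, ?_⟩
    · rw [mem_ball_zero_iff, hq₀, norm_mul, norm_real, norm_I, mul_one, Real.norm_eq_abs,
        abs_of_pos (half_pos ht0)]
      exact half_lt_self ht0
    · show 0 < q₀.im
      rw [hq₀]
      simpa using ht0
  have key := Identification.sub_eq_sub_of_exp_eq_mul_exp hNpc (subset_closure hq₀N) hMN hLA
    one_pos hexpN (hMN.continuousWithinAt hq₀N) (hLA.continuousWithinAt hq₀N)
  set C : ℂ := L (A q₀) - M q₀ with hC
  have hCexp : exp C = 1 := by
    rw [hC, exp_sub, hexpN q₀ hq₀N, ofReal_one, one_mul, div_self (exp_ne_zero _)]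
  obtain ⟨m, hm⟩ := Complex.exp_eq_one_iff.1 hCexp
  have hCim : C.im = m * (2 * Real.pi) := by
    rw [hm]; simp
  refine ⟨t, β + m * (2 * Real.pi), ht0, hts, ?_, ?_⟩
  · push_cast
    rw [add_mul, exp_add, hβ, show (m : ℂ) * (2 * Real.pi) * I = m * (2 * Real.pi * I) by ring,
      exp_int_mul_two_pi_mul_I, mul_one]
  · intro q hq hlev
    set x : ℂ := conj τ * (q - z) with hx
    have hAx : A x = q := hAinv q
    have hxim : x.im = 0 := by rw [← hAlev x, hAx]; exact hlev
    have hxt : x ∈ ball (0 : ℂ) t := by rw [hAball, hAx]; exact hq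
    have hT : Tendsto (fun w => L (A w)) (𝓝[N] x) (𝓝 (M x + C)) := by
      have hM0 : Tendsto M (𝓝[N] x) (𝓝 (M x)) :=
        ((hMc.continuousAt (isOpen_ball.mem_nhds hxt)).tendsto).mono_left nhdsWithin_le_nhds
      refine (hM0.add_const C).congr' ?_
      filter_upwards [self_mem_nhdsWithin] with w hw
      have h := key w hw
      rw [hC]
      linear_combination -h
    have hmap : Tendsto (fun w => conj τ * (w - z)) (𝓝[D.carrier] q) (𝓝[N] x) := by
      refine tendsto_nhdsWithin_iff.2 ⟨?_, ?_⟩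
      · have hcont : Continuous fun w : ℂ => conj τ * (w - z) := by fun_prop
        exact (hcont.tendsto q).mono_left nhdsWithin_le_nhds
      · have hb : ball z t ∈ 𝓝[D.carrier] q := mem_nhdsWithin_of_mem_nhds (isOpen_ball.mem_nhds hq)
        filter_upwards [hb, self_mem_nhdsWithin] with w hw hwU
        have hw' : conj τ * (w - z) ∈ ball (0 : ℂ) t := by
          rw [mem_ball_zero_iff, norm_mul, norm_conj, hτ1, one_mul, ← dist_eq_norm]
          exact hw
        refine ⟨hw', ?_⟩
        show 0 < (conj τ * (w - z)).im
        rw [← hAlev, hAinv]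
        have : w ∈ D.carrier ∩ ball z s := ⟨hwU, ball_subset_ball hts hw⟩
        rw [hflat] at this
        exact this.1
    have h : Tendsto (fun w => L w) (𝓝[D.carrier] q) (𝓝 (M x + C)) :=
      (hT.comp hmap).congr (fun w => by simp only [Function.comp_apply, hAinv])
    have h' : Tendsto (fun w => (L w).im) (𝓝[D.carrier] q) (𝓝 (M x + C).im) :=
      (continuous_im.tendsto _).comp h
    have hlim : (M x + C).im = β + m * (2 * Real.pi) := by rw [add_im, hMim x hxt hxim, hCim]
    rw [← hlim]
    exact h'

/-! ### Registered form -/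

/-- **Registered helper `phaseBookkeeping_flatChart`** (∀-closed form of `flatChart`; sub-goal of
stub `boundaryPhaseBookkeeping`, crux stmt-CriticalPhenomena-14004, line
`polygon-parity-squeeze`): boundary values of `arg Φ'` on a flat side.
[cite: PommerenkeBBCM1992, Thm. 2.6] -/
theorem phaseBookkeeping_flatChart : ∀ (D : DobrushinDomain) (Φ : ConformalEquiv D.carrier UpperHalfPlane.upperHalfPlaneSet), Filter.Tendsto (fun z => ‖Φ z‖) (𝓝[D.carrier] (D.pt 0)) Filter.atTop → ∀ (L : ℂ → ℂ), ContinuousOn L D.carrier → (∀ z ∈ D.carrier, Complex.exp (L z) = deriv Φ z) → ∀ (z n : ℂ) (s : ℝ), ‖n‖ = 1 → 0 < s → D.carrier ∩ Metric.ball z s = {w : ℂ | 0 < ((w - z) * (starRingEnd ℂ) n).re} ∩ Metric.ball z s → D.pt 0 ∉ Metric.ball z s → ∃ (t α : ℝ), 0 < t ∧ t ≤ s ∧ Complex.exp ((α : ℂ) * Complex.I) = Complex.I * (starRingEnd ℂ) n ∧ ∀ q ∈ Metric.ball z t, ((q - z) * (starRingEnd ℂ) n).re = 0 → Filter.Tendsto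 (fun w => (L w).im) (𝓝[D.carrier] q) (𝓝 α) :=
  fun D Φ hΦ0 _ hL hexp _ _ _ hn hs hflat h0 => flatChart D Φ hΦ0 hL hexp hn hs hflat h0

end PhaseChart

end Summit.CriticalPhenomena.SAWScalingLimit.Theorems.PolygonParitySqueeze

end
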